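import Summits.BirchSwinnertonDyer.BirchSwinnertonDyer.Theorems.SylvesterTwoHeegnerIndexCoupledTelescopeFlipCore
import Summits.BirchSwinnertonDyer.BirchSwinnertonDyer.Theorems.SylvesterTwoHeegnerIndexCMDataClassInvariance
import Summits.BirchSwinnertonDyer.BirchSwinnertonDyer.Theorems.SylvesterTwoHeegnerIndexCoupledTelescopeFrobFix
import Summits.BirchSwinnertonDyer.BirchSwinnertonDyer.Theorems.SylvesterTwoHeegnerIndexCoupledTelescopeDerivList
import Summits.BirchSwinnertonDyer.BirchSwinnertonDyer.Theorems.SylvesterTwoHeegnerIndexCMFlipPairLift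
import HarnessLib

/-!
# The COUPLED Cassels–Tate telescope, XXXVII: glue for the FLIP between two LEVELS of the (T-L1) class system
# (RESIDUE c v3 l.87–98; crux `UpperOffV0HSYPlus`, stmt-BirchSwinnertonDyer-19804)

The FLIP core `flip_core_sylvesterTower` ((T9), `…CoupledTelescopeFlipCore`) is stated for two points `z, z₀` at ONE
level `K[9p(ℓm)]`; the rows' class term `c_X(n)` is built at ITS OWN level `K[9pn]` along a list of generators.
This file supplies the instance-robust glue used by `…CoupledTelescopePairFlip` (all lemmas over an ARBITRARY
equality instance on the level field — the level files add points with the subfield instance, the point maps `ιe`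
are typed with `Classical.propDecidable`):
* `invPoints_mono` — `invPoints` is monotone in the module;
* `foldr_derivOp_map_inclusion` — `D^{(ℓm)}_{lift l}(z↑) = (D^{(m)}_l z)↑` (the `D_σ`-form of (T15)
  `apply_inclusion_eq_of_restrict` asked for in planner D724; `derivOp_map_inclusion` iterated);
* `map_smul_derivOp_eq_of_forall'`, `forall_geomReduction_derivOp_of_forall'`,
  `forall_geomReduction_foldr_of_forall` — the conjugate-wise (ES2) relation passes through `D_σ` and `D_l`
  ((T10) re-derived for an arbitrary instance and a bare point map);
* `geomReduction_eq_frob_smul_of_level` — #20 (ES2) on HSY's tower at a free level `N = 9p(ℓm)`.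
Theorems only (no definition / named fact / instance / notation); nothing asserted on 19804; no stub closed;
X12.CMAtTwo NOT proved; BSD not claimed for any curve.  Sources: [GrossLMS1991] §3 (3.5), §4 (4.1), Prop. 6.2 (2);
[Nekovar2007] Prop. 4.9; [HuShuYin2019] §4.1.  `lean search 'foldr_derivOp_map_inclusion|geomReduction_eq_frob_smul_of_level'` → nothing before this file.
-/

set_option linter.dupNamespace false -- Summits modules are `Summit.<Summit>.<Problem>…` by design
set_option autoImplicit false

noncomputable section

open scoped Classical Pointwise

namespace Summit.BirchSwinnertonDyer.BirchSwinnertonDyer.Theorems.SylvesterTwoCMFlip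

open WeierstrassCurve Field NumberField IsDedekindDomain Finset
open Literature.NumberTheory.EllipticCurves Literature.NumberTheory.GaloisRepresentations
  Literature.NumberTheory.EllipticCurves.ModularForms
  Literature.NumberTheory.EllipticCurves.HuShuYin2019
  Literature.NumberTheory.EllipticCurves.KolyvaginCocycle
  Literature.NumberTheory.EllipticCurves.RingClassField
  Summit.BirchSwinnertonDyer.BirchSwinnertonDyer.Theorems.SylvesterTwoCMData
  Summit.BirchSwinnertonDyer.Rank1Residual.X11b
  Summit.BirchSwinnertonDyer.Rank1Residual.X11b.RingClassTower

variable {K : Type} [Field K] [NumberField K]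

/-- `invPoints` is monotone in the module: `A ≤ A' ⟹ invPoints Γ A n ≤ invPoints Γ A' n`. [folklore] -/
theorem invPoints_mono {G M : Type*} [Group G] [AddCommGroup M] [DistribMulAction G M]
    {A A' : AddSubgroup M} (h : A ≤ A') (n : ℤ) : invPoints G A n ≤ invPoints G A' n := by
  rintro P ⟨hP, hPG⟩
  refine ⟨h hP, fun g ↦ ?_⟩
  obtain ⟨R, hR, hRe⟩ := hPG g
  exact ⟨R, h hR, hRe⟩

/-- **`D^{(m)}_{l'}(z↑) = (D^{(m')}_l z)↑`** along an inclusion `K[m'] ⊆ K[m]`, for lists `l'` over `K[m]` and `l`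
over `K[m']` with the same primes and compatible automorphisms (`σ' ∘ incl = incl ∘ σ`); `derivOp_map_inclusion`
iterated. [cite: GrossLMS1991, §3 (3.5), §4 (4.1)] -/
theorem foldr_derivOp_map_inclusion {W : WeierstrassCurve ℚ} (ι : K →+* ℂ) {m' m : ℕ}
    (hle : ringClassField K ι m' ≤ ringClassField K ι m)
    {l' : List ((ringClassField K ι m ≃ₐ[ℚ] ringClassField K ι m) × ℕ)}
    {l : List ((ringClassField K ι m' ≃ₐ[ℚ] ringClassField K ι m') × ℕ)}
    (h : List.Forall₂ (fun a b ↦ a.2 = b.2 ∧ ∀ x : ringClassField K ι m',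
      a.1 (RingClassField.inclusion ι hle x) = RingClassField.inclusion ι hle (b.1 x)) l' l)
    (y : (W.baseChange (ringClassField K ι m')).toAffine.Point) :
    l'.foldr (fun a z ↦ KolyvaginOperator.derivOp (pointGalHom W (ringClassField K ι m)) a.1 a.2 z)
        (Affine.Point.map (W' := W) ((RingClassField.inclusion ι hle).restrictScalars ℚ) y) =
      Affine.Point.map (W' := W) ((RingClassField.inclusion ι hle).restrictScalars ℚ)
        (l.foldr (fun a z ↦ KolyvaginOperator.derivOp (pointGalHom W (ringClassField K ι m')) a.1 a.2 z) y) := by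
  induction h with
  | nil => rfl
  | @cons a b l' l hab _ ih =>
    rw [List.foldr_cons, List.foldr_cons, ih, hab.1]
    exact derivOp_map_inclusion ι hle hab.2 b.2 _

/-- A `γ`-wise congruence passes through a derivative operator — `map_smul_derivOp_eq_of_forall` of
`…CMFlipLevelPairPrep` for an ARBITRARY equality instance on `L` (the level files use the subfield instance).
[cite: GrossLMS1991, Prop. 6.2 (2) (proof, p. 245)] -/
theorem map_smul_derivOp_eq_of_forall' (W : WeierstrassCurve ℚ) {L : Type} [Field L] [CharZero L] [DecidableEq L]
    {Γ X B : Type*} [Group Γ] [AddCommGroup X] [DistribMulAction Γ X] [AddCommGroup B]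
    (ιL : (W.baseChange L).toAffine.Point → X) (hι0 : ιL 0 = 0) (hιadd : ∀ P Q, ιL (P + Q) = ιL P + ιL Q)
    (red : X →+ B) (φ : B →+ B) (g : Γ)
    (σ' : L ≃ₐ[ℚ] L) (ℓ' : ℕ) {y y₀ : (W.baseChange L).toAffine.Point}
    (h : ∀ k : ℕ, red (g • ιL (pointGalHom W L (σ' ^ k) y)) = φ (red (g • ιL (pointGalHom W L (σ' ^ k) y₀)))) :
    red (g • ιL (KolyvaginOperator.derivOp (pointGalHom W L) σ' ℓ' y)) =
      φ (red (g • ιL (KolyvaginOperator.derivOp (pointGalHom W L) σ' ℓ' y₀))) := by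
  let ιh : (W.baseChange L).toAffine.Point →+ X := { toFun := ιL, map_zero' := hι0, map_add' := hιadd }
  have hιh : ∀ P, ιL P = ιh P := fun _ ↦ rfl
  simp only [hιh] at h ⊢
  unfold KolyvaginOperator.derivOp
  simp only [map_sum, Finset.smul_sum, map_nsmul, smul_comm g (_ : ℕ)]
  exact Finset.sum_congr rfl fun k _ ↦ by rw [h k]

/-- The conjugate-wise (ES2) relation passes through ONE derivative operator — (T10)
`forall_geomReduction_derivOp_of_forall` for an ARBITRARY equality instance on `L`.
[cite: GrossLMS1991, Prop. 6.2 (2) (proof)] [cite: Nekovar2007, Prop. 4.9] -/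
theorem forall_geomReduction_derivOp_of_forall' (W : WeierstrassCurve ℚ) {L : Type} [Field L] [CharZero L]
    [DecidableEq L] {Γ X B : Type*} [Group Γ] [AddCommGroup X] [DistribMulAction Γ X] [AddCommGroup B]
    {Φ : Type*} [SMul Φ B] (φ₀ : Φ) (hφ₀ : ∀ b c : B, φ₀ • (b + c) = φ₀ • b + φ₀ • c) (hφ₀0 : φ₀ • (0 : B) = 0)
    (ιL : (W.baseChange L).toAffine.Point → X) (hι0 : ιL 0 = 0) (hιadd : ∀ P Q, ιL (P + Q) = ιL P + ιL Q)
    (red : X →+ B)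
    (S : Set (L ≃ₐ[ℚ] L)) {σ' : L ≃ₐ[ℚ] L} (hS : ∀ γ ∈ S, ∀ k : ℕ, σ' ^ k * γ ∈ S)
    (hcomm : ∀ γ ∈ S, Commute γ σ') (q : ℕ) {y y₀ : (W.baseChange L).toAffine.Point}
    (h : ∀ γ ∈ S, ∀ g : Γ, red (g • ιL (pointGalHom W L γ y)) = φ₀ • red (g • ιL (pointGalHom W L γ y₀))) :
    ∀ γ ∈ S, ∀ g : Γ,
      red (g • ιL (pointGalHom W L γ (KolyvaginOperator.derivOp (pointGalHom W L) σ' q y))) =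
        φ₀ • red (g • ιL (pointGalHom W L γ (KolyvaginOperator.derivOp (pointGalHom W L) σ' q y₀))) := by
  intro γ hγ g
  rw [pointGalHom_derivOp_comm W (hcomm γ hγ) q y, pointGalHom_derivOp_comm W (hcomm γ hγ) q y₀]
  let φ : B →+ B := { toFun := fun b ↦ φ₀ • b, map_zero' := hφ₀0, map_add' := hφ₀ }
  refine map_smul_derivOp_eq_of_forall' W ιL hι0 hιadd red φ g σ' q (y := pointGalHom W L γ y)
    (y₀ := pointGalHom W L γ y₀) fun k ↦ ?_
  change red (g • ιL (pointGalHom W L (σ' ^ k) (pointGalHom W L γ y))) =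
    φ₀ • red (g • ιL (pointGalHom W L (σ' ^ k) (pointGalHom W L γ y₀)))
  have e : ∀ w, pointGalHom W L (σ' ^ k) (pointGalHom W L γ w) = pointGalHom W L (σ' ^ k * γ) w :=
    fun w ↦ by rw [map_mul]; rfl
  rw [e, e]
  exact h _ (hS γ hγ k) g

/-- **The conjugate-wise (ES2) relation passes through `D_l`** (the previous lemma along a list): `S` stable under
`(σ^k) * ·` for the `σ` of the list and commuting with them. [cite: GrossLMS1991, Prop. 6.2 (2) (proof)]
[cite: Nekovar2007, Prop. 4.9] -/
theorem forall_geomReduction_foldr_of_forall (W : WeierstrassCurve ℚ) {L : Type} [Field L] [CharZero L]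
    [DecidableEq L] {Γ X B : Type*} [Group Γ] [AddCommGroup X] [DistribMulAction Γ X] [AddCommGroup B]
    {Φ : Type*} [SMul Φ B] (φ₀ : Φ) (hφ₀ : ∀ b c : B, φ₀ • (b + c) = φ₀ • b + φ₀ • c) (hφ₀0 : φ₀ • (0 : B) = 0)
    (ιL : (W.baseChange L).toAffine.Point → X) (hι0 : ιL 0 = 0) (hιadd : ∀ P Q, ιL (P + Q) = ιL P + ιL Q)
    (red : X →+ B)
    (S : Set (L ≃ₐ[ℚ] L)) (l : List ((L ≃ₐ[ℚ] L) × ℕ)) (hS : ∀ γ ∈ S, ∀ a ∈ l, ∀ k : ℕ, a.1 ^ k * γ ∈ S)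
    (hcomm : ∀ γ ∈ S, ∀ a ∈ l, Commute γ a.1) {y y₀ : (W.baseChange L).toAffine.Point}
    (h : ∀ γ ∈ S, ∀ g : Γ, red (g • ιL (pointGalHom W L γ y)) = φ₀ • red (g • ιL (pointGalHom W L γ y₀))) :
    ∀ γ ∈ S, ∀ g : Γ,
      red (g • ιL (pointGalHom W L γ (l.foldr (fun a z ↦ KolyvaginOperator.derivOp (pointGalHom W L) a.1 a.2 z) y))) =
        φ₀ • red (g • ιL (pointGalHom W L γ (l.foldr (fun a z ↦ KolyvaginOperator.derivOp (pointGalHom W L) a.1 a.2 z) y₀))) := by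
  induction l with
  | nil => exact h
  | cons a l ih =>
    intro γ hγ g
    rw [List.foldr_cons, List.foldr_cons]
    exact forall_geomReduction_derivOp_of_forall' W φ₀ hφ₀ hφ₀0 ιL hι0 hιadd red S
      (fun γ hγ k ↦ hS γ hγ a List.mem_cons_self k) (fun γ hγ ↦ hcomm γ hγ a List.mem_cons_self) a.2
      (ih (fun γ hγ b hb k ↦ hS γ hγ b (List.mem_cons_of_mem a hb) k)
        (fun γ hγ b hb ↦ hcomm γ hγ b (List.mem_cons_of_mem a hb))) γ hγ g

/-- **#20 (ES2) on HSY's tower at a free level `N = 9p(ℓm)`**: for the CM points `y` over `φ(τ_{Q^{(ℓm)}})` and `y₀`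
over `φ(τ_{Q^{(m)}})` in `W(K[N])`, every `γ ∈ Aut(K[N])`, `g ∈ Γ_K`: `red(θ⁻¹(g • ι(γ y))) = φ₀ • red(θ⁻¹(g • ι(γ y₀)))`
(`geomReduction_sylvesterTower_eq_frob_smul`, level written `9p(mℓ)` there). [cite: Nekovar2007, Prop. 4.9]
[cite: GrossLMS1991, Prop. 6.2 (2)] -/
theorem geomReduction_eq_frob_smul_of_level (hES2 : Nekovar2007.cmPoint_frobeniusCongruence)
    (hK : IsImaginaryQuadratic K) (hdK : NumberField.discr K = -3) (ι : K →+* ℂ)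
    {W : WeierstrassCurve ℚ} [W.IsElliptic] [W.IsGloballyMinimal]
    (Dt : ModularParametrizationData W 243) {p ℓ m N : ℕ} (hN : 9 * p * (ℓ * m) = N) (hp : p % 3 = 1)
    (hm : m ≠ 0) (hm3 : ∀ q ∈ m.primeFactors, q % 3 = 2) [Fact ℓ.Prime] (hℓ2 : ℓ ≠ 2) (hℓ3 : ℓ % 3 = 2)
    (hℓpm : ¬ ℓ ∣ p * m) (hinert : (Ideal.span {(ℓ : 𝓞 K)}).IsPrime)
    {y y₀ : (W.baseChange (ringClassField K ι N)).toAffine.Point}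
    (hy : Affine.Point.map (W' := W) (ringClassField K ι N).subtype.toRatAlgHom y =
      Dt.φ (heegnerTau (((ℓ * m : ℕ) : ℤ) ^ 2 * (81 * ((p : ℤ) ^ 2 + 4 * p + 16)),
        ((ℓ * m : ℕ) : ℤ) * (-(9 * (4 * (p : ℤ) ^ 2 + 17 * p + 72))), 4 * (p : ℤ) ^ 2 + 18 * p + 81)))
    (hy₀ : Affine.Point.map (W' := W) (ringClassField K ι N).subtype.toRatAlgHom y₀ =
      Dt.φ (heegnerTau ((m : ℤ) ^ 2 * (81 * ((p : ℤ) ^ 2 + 4 * p + 16)),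
        (m : ℤ) * (-(9 * (4 * (p : ℤ) ^ 2 + 17 * p + 72))), 4 * (p : ℤ) ^ 2 + 18 * p + 81)))
    (emb : ringClassField K ι N →+* AlgebraicClosure K)
    (ιe : letI : DecidableEq (ringClassField K ι N) := fun a b ↦ Classical.propDecidable (a = b)
      (W.baseChange (ringClassField K ι N)).toAffine.Point →+ geomPoints (W.baseChange K))
    (hιe : ∀ P, ιe P = Affine.Point.map (W' := W) emb.toRatAlgHom P)
    (hΔ : ¬ (ℓ : ℤ) ∣ minimalDiscriminantInt W) {φ₀ : absoluteGaloisGroup (ZMod ℓ)}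
    (hφ₀ : ∀ x : AlgebraicClosure (ZMod ℓ), φ₀ • x = x ^ ℓ) (g : absoluteGaloisGroup K)
    (γ : ringClassField K ι N ≃ₐ[ℚ] ringClassField K ι N) :
    geomReduction hΔ ((RatClosure.pointsEquiv (K := K) W).symm (g • ιe (pointGalHom W (ringClassField K ι N) γ y))) =
      φ₀ • geomReduction hΔ ((RatClosure.pointsEquiv (K := K) W).symm (g • ιe (pointGalHom W (ringClassField K ι N) γ y₀))) := by
  have hN' : 9 * p * (m * ℓ) = N := by rw [Nat.mul_comm m ℓ]; exact hN
  subst hN'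
  have hy' := hy
  rw [Nat.mul_comm ℓ m] at hy'
  rw [hιe, hιe]
  exact geomReduction_sylvesterTower_eq_frob_smul hES2 hK hdK ι Dt hp hm hm3 hℓ2 hℓ3 hℓpm hinert hy' hy₀
    (Affine.Point.map (W' := W) emb.toRatAlgHom) emb (fun _ ↦ ⟨_, rfl⟩) hΔ hφ₀ g γ

end Summit.BirchSwinnertonDyer.BirchSwinnertonDyer.Theorems.SylvesterTwoCMFlip

end
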